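import Summits.QuantumFields.BalabanUV.Beta.GAN24.CombExitFaceCurrentCellTotals
import Summits.QuantumFields.BalabanUV.Beta.GAN24.CombesThomas

/-!
# `BalabanUV.Beta.GAN24.CombExitFaceCurrentCellTotalsAn1` — binder row G-an2-4 ∕ (CONV-C), W-slot CT-W, the COMB chart (III′): **(Z)_comb(j+1) IN THE OWNER's LETTERS** — the
# hypothesis `hZ` of OWNER gan24-p1 g53's `CombForcingWordsSucc` ∕ `CombForcingPairFormSucc` (journal [GAN24P1-G53-INTENT-2], l.67678) DISCHARGED: generic `d` at the Ward pins with the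
# kernel root spelled `toSite (ctrOff (d+1) Lc)` (§1), and an1's `d = 3` literal (units `sfStep Lc (j+1)`, `smStep 3 Lc (j+1)`, record `symTablesAn1S2 3 Lc cΛ`, pins `cE = Lc⁴`,
# `cVH = −Lc⁸∕2`) VERBATIM (§2) — both ONE `rw` away from my R `CombExitFaceCurrentCellTotals.comb_sum_box_current_E_eq_zero`

NOT IN PRINT; OUR BOOKKEEPING ([folklore] respelling BY NAME: `ctr (d+1) Lc = toSite (ctrOff (d+1) Lc)` (`rfl`), `Lc^(3+1) = Lc⁴`, `−(Lc^(3+1)·½·Lc^(3+1)) = −Lc⁸∕2` (`ring`); G-an2-4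
formalisation swarm, leaf prover `b2b-balaban-gan24-formalise-leaf-01`, gen 87, file S).  HONEST FRAMING (cell contract, verbatim): «discharging `BetaPertH` makes Bałaban's UV stability
UNCONDITIONAL — a real constructive-QFT result; it is NOT the continuum limit and NOT the Clay problem.»  HONEST DEPENDENCY (verbatim): «continuum YM on T⁴ ⇐ BetaPertH ∧ nine spine
estimates (0/9 proved); BetaPertH ⇐ (D1) ∧ (D4) ∧ CAP+tail; G-an2-4 gates asym, D1 and NE2/3/4.»

WHAT ([folklore]; `[NeZero Lc]`, `Odd Lc`, `3 ≤ Lc`; 0 `def`, 0 cited facts, 0 `def … : Prop`, 0 sorry): §1 **`comb_sum_box_current_E_eq_zero'`** (generic `d`, every `j cΛt cΛ`, all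
units, the Ward pins, root `toSite (ctrOff (d+1) Lc)`); §2 **`comb_sum_box_current_E_eq_zero_an1`** — the OWNER's `hZ` at `d = 3` VERBATIM.  With it the OWNER's
`pairFormLS_combForcing_succ_an1_of_pairForm` needs ONLY `hR` (J2_comb(j+1), the `E ⊗ E` pair form at the comb data — OPEN).  Asserts NO value of Bałaban's tables; NEVER
«G-an2-4 closed» as (CONV-C); NOT D1, NOT `BetaPertH`, NOT continuum, NOT Clay.  2026-08-27; no existing file touched.
-/

noncomputable section

open Finset
open scoped BigOperators
open Literature.MathematicalPhysics.QuantumFieldTheory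
open Literature.MathematicalPhysics.QuantumFieldTheory.Balaban1983to89
open Literature.MathematicalPhysics.QuantumFieldTheory.Balaban1983to89.Beta
open ExpKernelCalculus (Site MKer comp)
open AffineAveraging (box toSite)
open AveragingContoursRooted (ctr ctrOff)
open OneStepResolventKernel (Fib)
open OneStepKernelFamily (KInvStep vertexOfK)
open BalabanStepJetsSucc (wE)
open Summit.QuantumFields.BalabanUV.Beta.TameKernelCalculus (trK)
open Summit.QuantumFields.BalabanUV.Beta.AxialDressingRooted (coDressKBmAt)
open Summit.QuantumFields.BalabanUV.Beta.HessKerDressedUnits (unitK unitS)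
open Summit.QuantumFields.BalabanUV.Beta.SpineRooted (e3OfK)
open Summit.QuantumFields.BalabanUV.Beta.SymSecondOrderTablesAn1 (symTablesAn1S2)
open Summit.QuantumFields.BalabanUV.Beta.CombChartStepJets (ScombOf)
open Summit.QuantumFields.BalabanUV.Beta.SymCorrectorKernel (psiKS)
open Summit.QuantumFields.BalabanUV.Beta.SymCorrectorFace (slotPsiS)
open Summit.QuantumFields.BalabanUV.Beta.GAN24.CombesThomas (sfStep smStep)
open Summit.QuantumFields.BalabanUV.Beta.GAN24.CombExitFaceCurrentCellTotals (comb_sum_box_current_E_eq_zero)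

namespace Summit.QuantumFields.BalabanUV.Beta.GAN24.CombExitFaceCurrentCellTotalsAn1

variable {Lc : ℕ} [NeZero Lc]

/-! ## §1 Generic `d`, the Ward pins, root spelled `toSite (ctrOff (d+1) Lc)` -/

/-- [folklore] **(Z)_comb(j+1) IN THE OWNER's GENERIC LETTERS AT THE WARD PINS** (`Odd Lc`, `3 ≤ Lc`, every `d j cΛt cΛ`, all units `s_f s_m`; the `hZ` of
`CombForcingPairFormSucc.pairFormLS_combForcing_succ_of_pairForm` at `cE := Lc^(d+1)`, `cVH := −(Lc^(d+1)·½·Lc^(d+1))`). -/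
theorem comb_sum_box_current_E_eq_zero' {d : ℕ} (hLo : Odd Lc) (hLc : 3 ≤ Lc) (cΛt sf sm cΛ : ℝ) (j : ℕ) :
    ∀ (κ₀ γ b : Fin (d + 1)), ∑ r' ∈ box (d + 1) Lc, ∑' uw : Site (d + 1) × Site (d + 1), (if uw.2 γ % (Lc : ℤ) = (Lc : ℤ) - 1 then (1 : ℝ) else 0) *
        vertexOfK (unitK sf sm (coDressKBmAt (toSite (ctrOff (d + 1) Lc)) Lc (KInvStep (d := d) Lc (j + 1)))) Lc (unitS sf sm (fun κ t => ((Lc : ℝ) ^ (d + 1) * wE d Lc (j + 1)) • e3OfK Lc (coDressKBmAt (toSite (ctrOff (d + 1) Lc)) Lc (KInvStep (d := d) Lc j))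
              (fun κ u => comp (comp (trK (psiKS (ctrOff (d + 1) Lc) Lc)) (slotPsiS (ctrOff (d + 1) Lc) Lc (ScombOf (symTablesAn1S2 d Lc cΛt) ((Lc : ℝ) ^ (d + 1)) (-((Lc : ℝ) ^ (d + 1) * (1 / 2) * (Lc : ℝ) ^ (d + 1))) cΛ j) κ u)) (psiKS (ctrOff (d + 1) Lc) Lc)) κ t)) κ₀ uw.1 (toSite r') uw.2 (Sum.inl b) (Sum.inl γ) = 0 := by
  intro κ₀ γ b
  have h := comb_sum_box_current_E_eq_zero (d := d) hLo hLc cΛt sf sm cΛ j κ₀ γ b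
  rw [show (ctr (d + 1) Lc : Site (d + 1)) = toSite (ctrOff (d + 1) Lc) from rfl] at h
  exact h

/-! ## §2 an1's `d = 3` literal -/

/-- [folklore] **(Z)_comb(j+1) — THE OWNER's `hZ` VERBATIM** (`d = 3`, units `sfStep Lc (j+1)` ∕ `smStep 3 Lc (j+1)`, record `symTablesAn1S2 3 Lc cΛ`, pins `cE = Lc⁴`, `cVH = −Lc⁸∕2`;
`Odd Lc`, `3 ≤ Lc`, every `j cΛ`): the hypothesis `hZ` of `CombForcingPairFormSucc.pairFormLS_combForcing_succ_an1_of_pairForm` DISCHARGED. -/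
theorem comb_sum_box_current_E_eq_zero_an1 (hLo : Odd Lc) (hLc : 3 ≤ Lc) (cΛ : ℝ) (j : ℕ) :
    ∀ (κ₀ γ b : Fin (3 + 1)), ∑ r' ∈ box (3 + 1) Lc, ∑' uw : Site (3 + 1) × Site (3 + 1), (if uw.2 γ % (Lc : ℤ) = (Lc : ℤ) - 1 then (1 : ℝ) else 0) *
        vertexOfK (unitK (sfStep Lc (j + 1)) (smStep 3 Lc (j + 1)) (coDressKBmAt (toSite (ctrOff (3 + 1) Lc)) Lc (KInvStep (d := 3) Lc (j + 1)))) Lc (unitS (sfStep Lc (j + 1)) (smStep 3 Lc (j + 1)) (fun κ t => ((Lc : ℝ) ^ 4 * wE 3 Lc (j + 1)) • e3OfK Lc (coDressKBmAt (toSite (ctrOff (3 + 1) Lc)) Lc (KInvStep (d := 3) Lc j))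
              (fun κ u => comp (comp (trK (psiKS (ctrOff (3 + 1) Lc) Lc)) (slotPsiS (ctrOff (3 + 1) Lc) Lc (ScombOf (symTablesAn1S2 3 Lc cΛ) ((Lc : ℝ) ^ 4) (-((Lc : ℝ) ^ 8 / 2)) cΛ j) κ u)) (psiKS (ctrOff (3 + 1) Lc) Lc)) κ t)) κ₀ uw.1 (toSite r') uw.2 (Sum.inl b) (Sum.inl γ) = 0 := by
  intro κ₀ γ b
  have h := comb_sum_box_current_E_eq_zero (d := 3) hLo hLc cΛ (sfStep Lc (j + 1)) (smStep 3 Lc (j + 1)) cΛ j κ₀ γ b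
  have e1 : -((Lc : ℝ) ^ (3 + 1) * (1 / 2) * (Lc : ℝ) ^ (3 + 1)) = -((Lc : ℝ) ^ 8 / 2) := by ring
  have e2 : ((Lc : ℝ) ^ (3 + 1)) = (Lc : ℝ) ^ 4 := by norm_num
  rw [show (ctr (3 + 1) Lc : Site (3 + 1)) = toSite (ctrOff (3 + 1) Lc) from rfl, e1, e2] at h
  exact h

end Summit.QuantumFields.BalabanUV.Beta.GAN24.CombExitFaceCurrentCellTotalsAn1

end
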